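import Mathlib.GroupTheory.GroupAction.ConjAct
import Literature.AnabelianGeometry.EtaleTheta.TemperedFrobenioidToyTorsionGenuine
import Literature.AnabelianGeometry.EtaleTheta.TemperedFrobenioidToyTorsionRatFn
import Literature.AnabelianGeometry.EtaleTheta.Discharge.Sec3Thm37Units

/-!
# [EtTh] Def. 3.6 (ii) / Prop. 3.4 (ii) / Lemma 5.8 proof: the torsion tempered Frobenioid has NON-TRIVIAL `O^×(X)`, is NOT of
# unit-trivial type, and hosts the SHARP form of the F-1306 clause (c1′) AT THE TEMPERED-FROBENIOID LEVEL (model file)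

S. Mochizuki, *The étale theta function …*, Publ. RIMS **45** (2009) [MochizukiEtTh2009], Prop. 3.4 (ii) p. 300 (PDF p. 74)
("`O_L^× = Ker(B₀ → Φ₀^gp)`"), Thm. 3.7 (i) p. 305 (PDF p. 79) ("of unit-profinite type [if `Λ = ℤ`] … of unit-trivial type [if
`Λ = ℝ`]"), Lemma 5.8 proof p. 331 (PDF p. 105) ("`Π^tp_Y` [i.e., `G_K` …] acts … via multiplication by an element of `μ_N(B_N)`");
[FrdI] Thm. 5.2 (i)/(ii) p. 100–101 [MochizukiFrdI2008]; [FrdII] Thm. 1.2 (i) (the lifts `(1, g, 0, 1)`).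
abc-iut cell, layer L2; seat abc-iut-f-125 (gen 3), self-named row «TORSION-TF» part 2 (sequel of R228-NEXT, abc-iut-L2-lead gen 4).
CLASS (b) MODEL FILE over `TemperedFrobenioidToyTorsionGenuine.lean` (this seat) — nothing landed is edited or restated; the generic
truth-value lemmas of `Discharge/Sec5CyclotomicCompatXRatFnNV.lean` (p442935) and the Galois action `ToyTorsion.rho` / swap lemma of
`TemperedFrobenioidToyTorsionRatFn.lean` (p444447) are consumed BY NAME.

WHAT, for `C := ToyTorsion.genuineTemperedFrobenioid R S` (Def. 3.6 (ii) over the genuine vocabularies, base `SingleObj ℤ`) and its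
model Frobenioid `C.category` ([FrdI] Thm. 5.2 (i)), at the Frobenius-trivial object `X = (⋆, 0)`:
* `torsionUnit v = (1, id, 0, ((0,v),0)) ∈ O^×(X)`, `v ∈ (ℤ/2)²`, of order `≤ 2` (`torsionUnit_mem_muTwo`), `≠ 1` for `v ≠ 0`; hence
  **`unitsSubgroup_ne_bot` / `not_isUnitTrivial`: `O^×(X) ≠ 1` — `C` is NOT of unit-trivial type** (contrast: every previously
  constructed tempered Frobenioid of the §5 NV rows has `O^× = 1`; print: `Λ = ℤ` gives unit-PROFINITE, not unit-trivial, type);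
* the section `sect : ℤ → Aut_C(X)`, `n ↦ (1, n, 0, 1)` of the regular Galois action `rho`, and the base-conjugation character
  `conjChar := conj ∘ sect` on `μ_2(X)`; `sect_gen_conj_torsionUnit`: `e(γ) u_{(a,b)} e(γ)⁻¹ = u_{(b,a)}` (the swap);
* TRUTH VALUES of (c1′) at `(X, ρ, N = 2, μ_2(X), m)`: `ratFnClause_conjChar` (HOLDS for `χ' = conj ∘ sect`), `conjChar_ne_one`
  (SHARP), `not_ratFnClause_one` (FAILS for `χ' = 1`), `ratFnClause_iff_eq_conjChar_conj` (for every reading `m` and every `χ'`: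
  (c1′) ⟺ `χ'(g) = m ∘ conjChar(g) ∘ m⁻¹`).
So the census line (c1′) (abc-iut-L2-t3) has a positive instance of its sharp form INSIDE THE CLASS `TemperedFrobenioid _ _ (treeCatVocab …)`
of w5-d164's toys, with `B = C.ratFnFunctor`, exactly the shape of p438316's `cyclotomicCharacterCompatX_ofBiKummerData_iff_ratFn`.
HONEST LABEL: degenerate geometry (one base object, `Aut(⋆) = ℤ`, `Φ₀ = ℕ`, constants `ℤ × (ℤ/2)²`, `μ_2 = (ℤ/2)²` not cyclic); a
consistency / non-vacuity object, NOT the tempered Frobenioid of a curve; a FACT row is an assumption label; no side is taken on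
[IUTchIII] Cor. 3.12; typed ≠ proved.
-/

noncomputable section

namespace Literature.AnabelianGeometry.EtaleTheta

open CategoryTheory Opposite Literature.AlgebraicGeometry.Frobenioids

universe w

namespace ToyTorsion

variable (R S : (Baseᵒᵖ ⥤ CommMonCat.{0}) → Prop)

/-! ### The object `X = (⋆, 0)` of the model Frobenioid of the torsion tempered Frobenioid -/

/-- The Frobenius-trivial object `X := (⋆, 0)` of `C.category` ([FrdI] Thm. 5.2 proof p.101).
[cite: MochizukiFrdI2008, Thm. 5.2 p.101] -/
def X₁ : (genuineTemperedFrobenioid R S).category := ⟨SingleObj.star (Multiplicative ℤ), 1⟩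

/-- **The regular Galois action `ρ : ℤ → Aut_{D}(X^bs)`**, `n ↦ (⋆ —n→ ⋆)` (the copy of `ToyTorsion.rho` at the base object of `X`).
[cite: MochizukiEtTh2009, Def 3.3 p.299 (PDF p.73)] -/
def rho₁ : Multiplicative ℤ →* Aut (X₁ R S).base where
  toFun n := ⟨n, n⁻¹, inv_mul_cancel n, mul_inv_cancel n⟩
  map_one' := Iso.ext rfl
  map_mul' _ _ := Iso.ext rfl

/-- `ρ(n)` is the arrow `n`. [cite: MochizukiEtTh2009, Def 3.3 p.299 (PDF p.73)] -/
@[simp] theorem rho₁_hom (n : Multiplicative ℤ) : (rho₁ R S n).hom = n := rfl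

/-- `ρ(n)⁻¹` is the arrow `n⁻¹`. [cite: MochizukiEtTh2009, Def 3.3 p.299 (PDF p.73)] -/
@[simp] theorem rho₁_inv (n : Multiplicative ℤ) : (rho₁ R S n).inv = n⁻¹ := rfl

/-- The divisor monoid `Φ` of `C` is divisorial objectwise (monoprime). [cite: MochizukiFrdI2008, Def. 1.1 (i) p.19] -/
theorem objectwise_isDivisorial :
    Objectwise (fun M _ => IsDivisorial M) (genuineTemperedFrobenioid R S).divisorMonoid := fun A =>
  MonoprimeStructure.isDivisorial (isMonoprime_pfImage (op A))

/-- `O^×(X)` is commutative, in the form `nTorsionIn` consumes ([FrdI] Rmk. 1.3.1). [cite: MochizukiFrdI2008, Thm. 5.2 (ii) p.101] -/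
theorem units_comm₁ :
    ∀ x ∈ (PreFrobenioidData.ofModel (genuineTemperedFrobenioid R S).divisorMonoid (genuineTemperedFrobenioid R S).ratFnFunctor
        (genuineTemperedFrobenioid R S).divBNatTrans).unitsSubgroup (X₁ R S),
      ∀ y ∈ (PreFrobenioidData.ofModel (genuineTemperedFrobenioid R S).divisorMonoid (genuineTemperedFrobenioid R S).ratFnFunctor
        (genuineTemperedFrobenioid R S).divBNatTrans).unitsSubgroup (X₁ R S), x * y = y * x :=
  fun x hx y hy => congrArg Subtype.val
    ((ModelFrobenioid.isMulCommutative_units (X₁ R S)).is_comm.comm (⟨x, hx⟩ : ModelFrobenioid.units (X₁ R S)) ⟨y, hy⟩)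

/-- `μ_2(X) ⊆ Aut_C(X)` ([FrdII] Def. 2.1 (i); the tree's `nTorsionIn`). [cite: MochizukiEtTh2009, Def 5.4 p.327 (PDF p.101)] -/
abbrev muTwo₁ : Subgroup (Aut (X₁ R S)) :=
  nTorsionIn ((PreFrobenioidData.ofModel (genuineTemperedFrobenioid R S).divisorMonoid (genuineTemperedFrobenioid R S).ratFnFunctor
    (genuineTemperedFrobenioid R S).divBNatTrans).unitsSubgroup (X₁ R S)) (units_comm₁ R S) 2

/-! ### The torsion units `(1, id, 0, ((0,v),0)) ∈ O^×(X)`: `C` is NOT of unit-trivial type -/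

/-- `ratFnTorsion 1 = 1`. [cite: MochizukiEtTh2009, Def 3.6 p.303 (PDF p.77)] -/
@[simp] theorem ratFnTorsion_one (A : Baseᵒᵖ) : ratFnTorsion R S A 1 = 1 := Subtype.ext rfl

/-- `Div_B(((0,v),0)) = 0`. [cite: MochizukiFrdI2008, Thm. 5.2 (i) p.100] -/
theorem of_one_eq_divB_ratFnTorsion (v : V) :
    Algebra.GrothendieckGroup.of (1 : (genuineTemperedFrobenioid R S).divisorMonoid.obj (op (X₁ R S).base)) =
      divB (genuineTemperedFrobenioid R S).divisorMonoid (genuineTemperedFrobenioid R S).ratFnFunctor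
        (genuineTemperedFrobenioid R S).divBNatTrans (op (X₁ R S).base) (ratFnTorsion R S _ v) := by
  rw [map_one]
  rfl

/-- **The torsion unit `u_v := (1, id, 0, ((0,v),0)) ∈ Aut_C(X)`** ([FrdI] Thm. 5.2 (ii): `O^×(A) ≅ Ker(B(A) → Φ(A)^gp)`; abc-iut-L1's
`unitAut`).  [cite: MochizukiFrdI2008, Thm. 5.2 (ii) p.101] -/
def torsionUnit₁ (v : V) : Aut (X₁ R S) :=
  ModelFrobenioid.unitAut (X₁ R S) 1 1 (ratFnTorsion R S _ v) (ratFnTorsion R S _ v⁻¹) (of_one_eq_divB_ratFnTorsion R S v)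
    (of_one_eq_divB_ratFnTorsion R S v⁻¹) (mul_one _)
    ((ratFnTorsion_mul R S _ v⁻¹ v).trans (by rw [inv_mul_cancel, ratFnTorsion_one]; rfl))

/-- The rational function of `u_v` is `((0,v),0)`. [cite: MochizukiFrdI2008, Thm. 5.2 (i) p.100] -/
@[simp] theorem unit_torsionUnit₁ (v : V) : ModelFrobenioid.unit (torsionUnit₁ R S v).hom = ratFnTorsion R S _ v := rfl

/-- `u_v ∈ O^×(X)`. [cite: MochizukiFrdI2008, Thm. 5.2 (ii) p.101] -/
theorem torsionUnit₁_mem_units (v : V) :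
    torsionUnit₁ R S v ∈ (PreFrobenioidData.ofModel (genuineTemperedFrobenioid R S).divisorMonoid
      (genuineTemperedFrobenioid R S).ratFnFunctor (genuineTemperedFrobenioid R S).divBNatTrans).unitsSubgroup (X₁ R S) :=
  ⟨rfl, rfl⟩

/-- A unit of `X` is determined by its rational function ([FrdI] Thm. 5.2 (i), `Φ` divisorial). [cite: MochizukiFrdI2008, Thm. 5.2 (i) p.100] -/
theorem eq_of_unit_eq₁ {u u' : Aut (X₁ R S)}
    (hu : u ∈ (PreFrobenioidData.ofModel (genuineTemperedFrobenioid R S).divisorMonoid (genuineTemperedFrobenioid R S).ratFnFunctor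
      (genuineTemperedFrobenioid R S).divBNatTrans).unitsSubgroup (X₁ R S))
    (hu' : u' ∈ (PreFrobenioidData.ofModel (genuineTemperedFrobenioid R S).divisorMonoid (genuineTemperedFrobenioid R S).ratFnFunctor
      (genuineTemperedFrobenioid R S).divBNatTrans).unitsSubgroup (X₁ R S))
    (h : ModelFrobenioid.unit u.hom = ModelFrobenioid.unit u'.hom) : u = u' :=
  ModelFrobenioid.aut_eq_of_baseMap_eq_of_unit_eq (objectwise_isDivisorial R S) (hu.1.trans hu'.1.symm) h

/-- The rational function of a product of units is the product. [cite: MochizukiFrdI2008, Thm. 5.2 (i) p.100] -/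
theorem unit_mul_of_mem_units₁ {u u' : Aut (X₁ R S)}
    (hu : u ∈ (PreFrobenioidData.ofModel (genuineTemperedFrobenioid R S).divisorMonoid (genuineTemperedFrobenioid R S).ratFnFunctor
      (genuineTemperedFrobenioid R S).divBNatTrans).unitsSubgroup (X₁ R S))
    (hu' : u' ∈ (PreFrobenioidData.ofModel (genuineTemperedFrobenioid R S).divisorMonoid (genuineTemperedFrobenioid R S).ratFnFunctor
      (genuineTemperedFrobenioid R S).divBNatTrans).unitsSubgroup (X₁ R S)) :
    ModelFrobenioid.unit (u * u').hom = ModelFrobenioid.unit u.hom * ModelFrobenioid.unit u'.hom := by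
  have hb : ModelFrobenioid.baseMap u'.hom = 𝟙 (X₁ R S).base := hu'.1
  have hd : ModelFrobenioid.degFr u.hom = 1 := hu.2
  change ModelFrobenioid.unit (u'.hom ≫ u.hom) = _
  rw [ModelFrobenioid.unit_comp, hb, hd, ModelFrobenioid.map_id_apply_B, PNat.one_coe, pow_one]

/-- Every element of `(ℤ/2)²` (multiplicatively) squares to `1`. [folklore] -/
private theorem mul_self_V₁ (v : V) : v * v = 1 := by
  have h : ∀ x : Multiplicative (ZMod 2), x * x = 1 := fun x => by
    apply Multiplicative.toAdd.injective
    rw [toAdd_mul, toAdd_one]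
    exact (by decide : ∀ y : ZMod 2, y + y = 0) _
  exact Prod.ext (h v.1) (h v.2)

/-- `u_v² = 1`: `u_v ∈ μ_2(X)`. [cite: MochizukiEtTh2009, Def 5.4 p.327 (PDF p.101)] -/
theorem torsionUnit₁_mem_muTwo (v : V) : torsionUnit₁ R S v ∈ muTwo₁ R S := by
  refine ⟨torsionUnit₁_mem_units R S v, ?_⟩
  rw [pow_two]
  refine eq_of_unit_eq₁ R S (Subgroup.mul_mem _ (torsionUnit₁_mem_units R S v) (torsionUnit₁_mem_units R S v)) (Subgroup.one_mem _) ?_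
  rw [unit_mul_of_mem_units₁ R S (torsionUnit₁_mem_units R S v) (torsionUnit₁_mem_units R S v), unit_torsionUnit₁]
  exact (ratFnTorsion_mul R S _ v v).trans (by rw [mul_self_V₁, ratFnTorsion_one]; rfl)

/-- `u_v ≠ 1` for `v ≠ 0`. [cite: MochizukiEtTh2009, Prop 3.4 p.300 (PDF p.74)] -/
theorem torsionUnit₁_ne_one {v : V} (hv : v ≠ 1) : torsionUnit₁ R S v ≠ 1 := fun h => by
  have h2 := congrArg (fun u : Aut (X₁ R S) => (ModelFrobenioid.unit u.hom).1.1.2) h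
  change ((ratFnTorsion R S _ v).1).1.2 = (ModelFrobenioid.unit (𝟙 (X₁ R S))).1.1.2 at h2
  rw [ModelFrobenioid.unit_id] at h2
  exact hv h2

/-- **`O^×(X) ≠ 1` for the torsion tempered Frobenioid** (it contains `u_{(1,0)}`). [cite: MochizukiEtTh2009, Prop 3.4 p.300 (PDF p.74)] -/
theorem unitsSubgroup_ne_bot :
    PreFrobenioid.unitsSubgroup (genuineTemperedFrobenioid R S).toElem (X₁ R S) ≠ ⊥ := fun h =>
  torsionUnit₁_ne_one R S (v := (Multiplicative.ofAdd (1 : ZMod 2), 1)) (by decide)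
    ((Subgroup.mem_bot).mp (h ▸ (ofModel_unitsSubgroup_eq_unitsSubgroup_toElem (X₁ R S) ▸ torsionUnit₁_mem_units R S _)))

/-- **The torsion tempered Frobenioid is NOT of unit-trivial type** ([FrdI] Def. 1.2 (iv); contrast [EtTh] Thm. 3.7 (i): unit-TRIVIAL
only at `Λ = ℝ`, unit-PROFINITE at `Λ = ℤ` — here `Λ = ℤ` and `O^×(X) ⊇ (ℤ/2)²`).  [cite: MochizukiEtTh2009, Thm 3.7 p.305 (PDF p.79)] -/
theorem not_isUnitTrivial :
    ¬ PreFrobenioid.IsOfType (PreFrobenioid.IsUnitTrivial (genuineTemperedFrobenioid R S).toElem) := fun h =>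
  unitsSubgroup_ne_bot R S ((Subgroup.eq_bot_iff_forall _).2 (h (X₁ R S)))

/-- `μ_2(X) ≠ 1`. [cite: MochizukiEtTh2009, Def 5.4 p.327 (PDF p.101)] -/
theorem muTwo₁_ne_bot : muTwo₁ R S ≠ ⊥ := fun h =>
  torsionUnit₁_ne_one R S (v := (Multiplicative.ofAdd (1 : ZMod 2), 1)) (by decide)
    ((Subgroup.mem_bot).mp (h ▸ torsionUnit₁_mem_muTwo R S (Multiplicative.ofAdd (1 : ZMod 2), 1)))

/-! ### The section `n ↦ (1, n, 0, 1)` of the regular Galois action and the base-conjugation character -/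

/-- The lift `(1, n, 0, 1) ∈ Aut_C(X)` of `n ∈ Aut(⋆) = ℤ` ([FrdII] Thm. 1.2 (i) lifts at a Frobenius-trivial object).
[cite: MochizukiFrdI2008, Thm. 5.2 p.101] -/
def lift₁ (n : Multiplicative ℤ) : Aut (X₁ R S) where
  hom := ⟨1, (rho₁ R S n).hom, 1, 1, by
    show (1 : Algebra.GrothendieckGroup _) ^ ((1 : ℕ+) : ℕ) * Algebra.GrothendieckGroup.of 1 =
      pullGp _ (rho₁ R S n).hom 1 * divB _ _ _ _ 1
    simp only [PNat.one_coe, pow_one, map_one, mul_one]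
    rfl⟩
  inv := ⟨1, (rho₁ R S n).inv, 1, 1, by
    show (1 : Algebra.GrothendieckGroup _) ^ ((1 : ℕ+) : ℕ) * Algebra.GrothendieckGroup.of 1 =
      pullGp _ (rho₁ R S n).inv 1 * divB _ _ _ _ 1
    simp only [PNat.one_coe, pow_one, map_one, mul_one]
    rfl⟩
  hom_inv_id := by
    apply ModelFrobenioid.hom_ext
    · exact mul_one _
    · exact (rho₁ R S n).hom_inv_id
    · change ((genuineTemperedFrobenioid R S).divisorMonoid.map (rho₁ R S n).hom.op).hom 1 * 1 ^ ((1 : ℕ+) : ℕ) = 1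
      rw [map_one, one_pow, mul_one]
    · change ((genuineTemperedFrobenioid R S).ratFnFunctor.map (rho₁ R S n).hom.op).hom 1 * 1 ^ ((1 : ℕ+) : ℕ) = 1
      rw [map_one, one_pow, mul_one]
  inv_hom_id := by
    apply ModelFrobenioid.hom_ext
    · exact mul_one _
    · exact (rho₁ R S n).inv_hom_id
    · change ((genuineTemperedFrobenioid R S).divisorMonoid.map (rho₁ R S n).inv.op).hom 1 * 1 ^ ((1 : ℕ+) : ℕ) = 1
      rw [map_one, one_pow, mul_one]
    · change ((genuineTemperedFrobenioid R S).ratFnFunctor.map (rho₁ R S n).inv.op).hom 1 * 1 ^ ((1 : ℕ+) : ℕ) = 1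
      rw [map_one, one_pow, mul_one]

/-- **The section `sect : ℤ → Aut_C(X)` of `ρ`** (a homomorphism; `Base ∘ sect = ρ`). [cite: MochizukiFrdI2008, Thm. 5.2 p.101] -/
def sect₁ : Multiplicative ℤ →* Aut (X₁ R S) where
  toFun := lift₁ R S
  map_one' := Iso.ext (ModelFrobenioid.hom_ext rfl rfl rfl rfl)
  map_mul' a b := by
    apply Iso.ext
    apply ModelFrobenioid.hom_ext
    · exact (mul_one _).symm
    · rfl
    · change (1 : (genuineTemperedFrobenioid R S).divisorMonoid.obj (op (X₁ R S).base)) =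
        ((genuineTemperedFrobenioid R S).divisorMonoid.map (rho₁ R S b).hom.op).hom 1 * 1 ^ ((1 : ℕ+) : ℕ)
      rw [map_one, one_pow, mul_one]
    · change (1 : (genuineTemperedFrobenioid R S).ratFnFunctor.obj (op (X₁ R S).base)) =
        ((genuineTemperedFrobenioid R S).ratFnFunctor.map (rho₁ R S b).hom.op).hom 1 * 1 ^ ((1 : ℕ+) : ℕ)
      rw [map_one, one_pow, mul_one]

/-- `Base(sect n) = ρ(n)`. [cite: MochizukiFrdI2008, Thm. 5.2 p.101] -/
theorem baseMap_sect₁ (n : Multiplicative ℤ) : ModelFrobenioid.baseMap (sect₁ R S n).hom = (rho₁ R S n).hom := rfl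

/-- `O^×(X)` is normal in `Aut_C(X)`. [cite: MochizukiFrdI2008, Thm. 5.2 (ii) p.101] -/
theorem unitsSubgroup_normal₁ :
    ((PreFrobenioidData.ofModel (genuineTemperedFrobenioid R S).divisorMonoid (genuineTemperedFrobenioid R S).ratFnFunctor
      (genuineTemperedFrobenioid R S).divBNatTrans).unitsSubgroup (X₁ R S)).Normal :=
  ⟨fun u hu e => ⟨ModelFrobenioid.baseMap_conj' e (f := u.hom) hu.1, ModelFrobenioid.degFr_conj' e (f := u.hom) hu.2⟩⟩

/-- `μ_2(X)` is normal in `Aut_C(X)`. [cite: MochizukiEtTh2009, §5 p.331 (PDF p.105)] -/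
theorem muTwo₁_normal : (muTwo₁ R S).Normal :=
  haveI := unitsSubgroup_normal₁ R S
  nTorsionIn_normal _ (units_comm₁ R S) 2

/-- **The base-conjugation character `conjChar := conj ∘ sect : ℤ → Aut(μ_2(X))`** — the Galois action on the torsion constants of
this tempered Frobenioid.  [cite: MochizukiEtTh2009, Lem 5.8 proof p.331 (PDF p.105)] -/
def conjChar₁ : Multiplicative ℤ →* MulAut (muTwo₁ R S) :=
  haveI := muTwo₁_normal R S
  MulAut.conjNormal.comp (sect₁ R S)

/-- `conjChar n u = sect n · u · (sect n)⁻¹`. [cite: MochizukiEtTh2009, Lem 5.8 proof p.331 (PDF p.105)] -/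
theorem conjChar₁_apply_coe (n : Multiplicative ℤ) (u : muTwo₁ R S) :
    ((conjChar₁ R S n u : muTwo₁ R S) : Aut (X₁ R S)) = sect₁ R S n * u.1 * (sect₁ R S n)⁻¹ :=
  haveI := muTwo₁_normal R S
  MulAut.conjNormal_apply (sect₁ R S n) u

/-- **Conjugation by `sect(γ)` SWAPS the torsion units**: `e(γ) u_{(a,b)} e(γ)⁻¹ = u_{(b,a)}` — the rational function is pulled back along
`Base(e(γ)⁻¹) = γ⁻¹`, which acts on `B = B₀^Λ ×_{…} Φ^gp` through the swap ([FrdI] Thm. 5.2 (i)).  [cite: MochizukiFrdI2008, Thm. 5.2 (i) p.100] -/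
theorem sect₁_gen_conj_torsionUnit₁ (v : V) :
    sect₁ R S gen * torsionUnit₁ R S v * (sect₁ R S gen)⁻¹ = torsionUnit₁ R S (v.2, v.1) := by
  have hmem := conj_mem_nTorsionIn (X₁ R S) (units_comm₁ R S) 2 (sect₁ R S gen) ⟨torsionUnit₁ R S v, torsionUnit₁_mem_muTwo R S v⟩
  refine eq_of_unit_eq₁ R S hmem.1 (torsionUnit₁_mem_units R S _) ?_
  rw [unit_conj_eq_pull_rho_of_baseMap_eq (X₁ R S) (units_comm₁ R S) (rho₁ R S) 2 gen (sect₁ R S gen) (baseMap_sect₁ R S gen)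
    ⟨torsionUnit₁ R S v, torsionUnit₁_mem_muTwo R S v⟩]
  change (genuineTemperedFrobenioid R S).ratFnPull (rho₁ R S gen).inv.op (ratFnTorsion R S _ v) = ratFnTorsion R S _ (v.2, v.1)
  rw [ratFnPull_ratFnTorsion]
  have hsw : (act (rho₁ R S gen).inv.op.unop (((1 : Multiplicative ℤ), v) : M)).2 = (v.2, v.1) := by
    change (pull divisorMonoids.B₀ (rho gen).inv (((1 : Multiplicative ℤ), v) : M)).2 = (v.2, v.1)
    rw [pull_rho_gen_inv, swapE_apply]
  rw [hsw]

/-- **`conjChar ≠ 1`**: the Galois action of the base MOVES a torsion constant of this tempered Frobenioid (`u_{(1,0)} ↦ u_{(0,1)}`).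
[cite: MochizukiEtTh2009, Lem 5.8 proof p.331 (PDF p.105)] -/
theorem conjChar₁_ne_one : conjChar₁ R S ≠ 1 := by
  intro h
  have hb : (Multiplicative.ofAdd (1 : ZMod 2), (1 : Multiplicative (ZMod 2))) ≠
      ((1 : Multiplicative (ZMod 2)), Multiplicative.ofAdd (1 : ZMod 2)) := by decide
  have key := conjChar₁_apply_coe R S gen ⟨torsionUnit₁ R S (Multiplicative.ofAdd (1 : ZMod 2), 1), torsionUnit₁_mem_muTwo R S _⟩
  rw [h, MonoidHom.one_apply, MulAut.one_apply, sect₁_gen_conj_torsionUnit₁] at key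
  have k2 := congrArg (fun u : Aut (X₁ R S) => (ModelFrobenioid.unit u.hom).1.1.2) key
  change ((ratFnTorsion R S _ (Multiplicative.ofAdd (1 : ZMod 2), (1 : Multiplicative (ZMod 2)))).1).1.2 =
    ((ratFnTorsion R S _ ((1 : Multiplicative (ZMod 2)), Multiplicative.ofAdd (1 : ZMod 2))).1).1.2 at k2
  exact hb k2

/-! ### Truth values of (c1′) at the tempered-Frobenioid level -/

/-- **(c1′) HOLDS at `(X, ρ, 2, μ_2(X), id)` of the torsion TEMPERED Frobenioid for `χ' := conj ∘ sect`** (p442935 §1a).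
[cite: MochizukiEtTh2009, Lem 5.8 proof p.331 (PDF p.105)] [cite: MochizukiFrdI2008, Thm. 5.2 (i) p.100] -/
theorem ratFnClause_conjChar₁ :
    ∀ (g : Multiplicative ℤ) (u u' : muTwo₁ R S),
      ModelFrobenioid.unit u'.1.hom = pull (genuineTemperedFrobenioid R S).ratFnFunctor (rho₁ R S g).inv (ModelFrobenioid.unit u.1.hom) →
        (MulEquiv.refl (muTwo₁ R S)) u' = conjChar₁ R S g ((MulEquiv.refl (muTwo₁ R S)) u) :=
  ratFnClause_of_section_of_forall_eq_conj (X₁ R S) (units_comm₁ R S) (rho₁ R S) 2 (MulEquiv.refl _) (conjChar₁ R S)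
    (objectwise_isDivisorial R S) (sect₁ R S) (baseMap_sect₁ R S) fun g u => Subtype.ext (conjChar₁_apply_coe R S g u)

/-- **(c1′) FAILS at the same datum for the trivial character.** [cite: MochizukiEtTh2009, Lem 5.8 proof p.331 (PDF p.105)] -/
theorem not_ratFnClause_one₁ :
    ¬ ∀ (g : Multiplicative ℤ) (u u' : muTwo₁ R S),
      ModelFrobenioid.unit u'.1.hom = pull (genuineTemperedFrobenioid R S).ratFnFunctor (rho₁ R S g).inv (ModelFrobenioid.unit u.1.hom) →
        (MulEquiv.refl (muTwo₁ R S)) u' = (1 : Multiplicative ℤ →* MulAut (muTwo₁ R S)) g ((MulEquiv.refl (muTwo₁ R S)) u) := by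
  intro h0
  have h := (ratFnClause_iff_forall_chi_apply_eq_conj_of_section (X₁ R S) (units_comm₁ R S) (rho₁ R S) 2 (MulEquiv.refl _) 1
    (objectwise_isDivisorial R S) (sect₁ R S) (baseMap_sect₁ R S)).mp h0
  apply conjChar₁_ne_one R S
  refine MonoidHom.ext fun g => MulEquiv.ext fun u => Subtype.ext ?_
  rw [conjChar₁_apply_coe]
  exact (congrArg Subtype.val (h g u)).symm

/-- **Reading-independent truth table**: for EVERY cyclotome reading `m : μ_2(X) ≃ M` and EVERY `χ' : ℤ → Aut(M)`, (c1′) at the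
torsion tempered Frobenioid ⟺ `χ'(g) = m ∘ conjChar(g) ∘ m⁻¹` for all `g`.  [cite: MochizukiEtTh2009, Lem 5.8 proof p.331 (PDF p.105)] -/
theorem ratFnClause_iff_eq_conjChar₁_conj {M : Type w} [Group M] (m : muTwo₁ R S ≃* M) (χ' : Multiplicative ℤ →* MulAut M) :
    (∀ (g : Multiplicative ℤ) (u u' : muTwo₁ R S),
      ModelFrobenioid.unit u'.1.hom = pull (genuineTemperedFrobenioid R S).ratFnFunctor (rho₁ R S g).inv (ModelFrobenioid.unit u.1.hom) →
        m u' = χ' g (m u)) ↔ ∀ g : Multiplicative ℤ, χ' g = (m.symm.trans (conjChar₁ R S g)).trans m := by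
  refine (ratFnClause_iff_forall_chi_apply_eq_conj_of_section (X₁ R S) (units_comm₁ R S) (rho₁ R S) 2 m χ'
    (objectwise_isDivisorial R S) (sect₁ R S) (baseMap_sect₁ R S)).trans ?_
  constructor
  · intro h g
    refine MulEquiv.ext fun x => ?_
    have hx := h g (m.symm x)
    rw [MulEquiv.apply_symm_apply] at hx
    rw [hx, MulEquiv.trans_apply, MulEquiv.trans_apply]
    exact (congrArg m (Subtype.ext (conjChar₁_apply_coe R S g (m.symm x)))).symm
  · intro h g u
    rw [h g, MulEquiv.trans_apply, MulEquiv.trans_apply, MulEquiv.symm_apply_apply]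
    exact congrArg m (Subtype.ext (conjChar₁_apply_coe R S g u))

end ToyTorsion

end Literature.AnabelianGeometry.EtaleTheta

end
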